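import Summits.NavierStokesRegularity.NavierStokesRegularity.Theorems.TypeILiouvilleTypeIliouvilleLWeakL3Recurrence
import Literature.Analysis.FluidPDE.OseenDuhamelPairCalculus
import Mathlib.Analysis.SpecialFunctions.ImproperIntegrals
import HarnessLib

/-!
# A finite `L²_t L^∞_x` budget on a past slab kills a mild bounded ancient solution
# (crux `TypeIliouvilleL`, stmt-NavierStokesRegularity-10661; stubs L', S3ᵐ, L_Q)

Helper file (theorems only, no definition, no named fact, no `sorry`; lands
`--supports stmt-NavierStokesRegularity-10661`).

The three registered stubs of the crux `TypeIliouvilleL` (KNSS Liouville conjecture (L)) —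
`stub_typeIAncientLiouville_knssGauge` (L' = stmt-4050, the Type-I regime),
`stub_persistent_mild_backward_L3_recurrence` (S3ᵐ, the persistent regime) and
`stub_quiescentLiouville` (L_Q) — all live in print's class of mild bounded ancient solutions
(KNSS 2009 §4 (i)): fields `v` continuous and uniformly bounded on `(−∞,0) × ℝ³`, Oseen-mild
(`v(t) = e^{(t−s)Δ}v(s) − B¹_s(v,v)(t)` for `s < t < 0`).  This file proves the Liouville theorem
on the sub-class with a finite budget in the ENDPOINT Ladyzhenskaya–Prodi–Serrin norm
`L²_t L^∞_x` (scale invariant, `2/2 + 3/∞ = 1`):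

* `SupSqBudget.oseenMild_eq_zero` — if `‖v(t,x)‖ ≤ g(t)` for `t < T` with `∫_{t<T} g² dt < ∞`,
  then `v ≡ 0` on the whole slab.  NO divergence-free, smoothness, symmetry or smallness
  hypothesis.  Mechanism (a nonlinear Volterra bootstrap, not a slice criterion): with
  `N = sup_{t<t₁} ‖v‖` and `G = ∫_{t<t₁} g²`, the mild identity from a far time `s` (where `g(s)`
  is as small as we please, `g²` being integrable on a half-line of infinite length), the caloric
  maximum principle and the KNSS bilinear bound `‖B_s(v,v)(t)‖ ≤ C₀∫ₛᵗ(t−τ)^{-1/2}M(τ)²dτ` split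
  at `t − δ` give `N ≤ C₀(δ^{-1/2}G + 2δ^{1/2}N²)` for every `δ > 0`; the choice `δ = G/N²`
  gives `N ≤ 3C₀√G·N`, so `N = 0` as soon as `9C₀²G < 1`, which holds for `t₁` near `−∞`;
  forward uniqueness of bounded mild solutions (`oseenMild_eq_zero_after_of_slice_eq_zero`)
  finishes.
* companion file `…SupNormSquareBudgetStubs`: the Galilean twin (`‖v(t,·) − b‖_∞ ∈ L²(−∞,T)`
  forces `v ≡ b`) and stub L' BY ITS BINDERS on the budget class (KNSS-gauge Type-I fields with
  `‖u(t)‖_∞ ∈ L²(−∞,T)` vanish).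
* `SupSqBudget.not_integrableOn_sq_of_persistent` — stub S3ᵐ's class (NOT Type-I) has INFINITE
  `L²_t L^∞_x` budget against every majorant on every past slab (so S3ᵐ and L_Q hold trivially on
  the budget class: it contains only `v ≡ 0`, resp. only constants after a boost).
* `SupSqBudget.not_integrableOn_typeIRate_sq` — sharpness of the exponent at the Type-I rate: the
  majorant `C/√(−t)` itself has `∫_{t<T} C²/(−t) dt = ∞` (`C ≠ 0`), so the theorem stops exactly
  one logarithm short of the Type-I regime: every rate `r(t)` with `∫^{T} r² < ∞`
  (e.g. `r = (−t)^{-1/2} log^{-(1+ε)/2}(−t)`) is killed, the rate `(−t)^{-1/2}` (stub L' =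
  stmt-4050, OPEN) is the first that is not.

WHAT THIS IS NOT: not (L), not L', not S3ᵐ: the open cores (Type-I rate with a large constant;
persistent flows) have infinite endpoint budget by the last two theorems.  Nothing here proves
anything about Navier–Stokes regularity.

References: Koch–Nadirashvili–Seregin–Šverák, Acta Math. 203 (2009) = arXiv:0709.3599, §4 p. 8
(the bilinear bound `‖B(u,v)‖ ≤ C√T‖u‖‖v‖`, uniqueness (4.3)–(4.4)); the endpoint Serrin class
`L²(0,T; L^∞)` as a regularity class: Robinson–Rodrigo–Sadowski 2016, Thm 8.17. [folklore]
-/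

set_option linter.dupNamespace false

noncomputable section

namespace Summit.NavierStokesRegularity.NavierStokesRegularity.Theorems.SupSqBudget

open MeasureTheory Set Filter Function
open scoped ENNReal NNReal Topology
open Literature.Analysis Literature.Analysis.FluidPDE

/-! ### Real-variable lemmas on square-integrable majorants -/

/-- A function whose square is integrable on a left half-line takes values `≤ η` below any
given time (a half-line has infinite Lebesgue measure). [folklore] -/
theorem exists_lt_and_le_of_integrableOn_sq {g : ℝ → ℝ} {a a' η : ℝ}
    (hint : IntegrableOn (fun t => g t ^ 2) (Iio a)) (ha' : a' ≤ a) (hη : 0 < η) :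
    ∃ s, s < a' ∧ g s ≤ η := by
  by_contra h
  push Not at h
  have hint' : IntegrableOn (fun t => g t ^ 2) (Iio a') := hint.mono_set (Iio_subset_Iio ha')
  have hlt : ∫⁻ t in Iio a', ‖g t ^ 2‖ₑ < ∞ := hint'.2
  have hge : ∫⁻ _ in Iio a', ENNReal.ofReal (η ^ 2) ≤ ∫⁻ t in Iio a', ‖g t ^ 2‖ₑ := by
    refine setLIntegral_mono' measurableSet_Iio fun t ht => ?_
    have h1 : η < g t := h t ht
    have h2 : η ^ 2 ≤ g t ^ 2 := by nlinarith
    rw [Real.enorm_eq_ofReal (sq_nonneg _)]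
    exact ENNReal.ofReal_le_ofReal h2
  have hη2 : ENNReal.ofReal (η ^ 2) ≠ 0 := (ENNReal.ofReal_pos.2 (by positivity)).ne'
  rw [setLIntegral_const, Real.volume_Iio, ENNReal.mul_top hη2, top_le_iff] at hge
  exact hlt.ne hge

/-- The tail integrals `∫_{t<t₁} g²` of a function square-integrable on `(−∞,a)` become smaller
than any `γ > 0` for `t₁ ≤ a` near `−∞` (dominated convergence along `Iio (a − n)`). [folklore] -/
theorem exists_setIntegral_Iio_sq_lt {g : ℝ → ℝ} {a γ : ℝ}
    (hint : IntegrableOn (fun t => g t ^ 2) (Iio a)) (hγ : 0 < γ) :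
    ∃ t₁, t₁ ≤ a ∧ ∫ t in Iio t₁, g t ^ 2 < γ := by
  set s : ℕ → Set ℝ := fun n => Iio (a - n) with hs
  have hsm : ∀ n, MeasurableSet (s n) := fun n => measurableSet_Iio
  have hanti : Antitone s := by
    intro m n hmn
    refine Iio_subset_Iio ?_
    have : (m : ℝ) ≤ n := by exact_mod_cast hmn
    linarith
  have h0 : IntegrableOn (fun t => g t ^ 2) (s 0) volume := by
    simpa [hs] using hint
  have hlim := Antitone.tendsto_setIntegral hsm hanti h0
  have hempty : (⋂ n, s n) = ∅ := by
    ext t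
    simp only [hs, mem_iInter, mem_Iio, mem_empty_iff_false, iff_false, not_forall, not_lt]
    obtain ⟨n, hn⟩ := exists_nat_gt (a - t)
    exact ⟨n, by linarith⟩
  rw [hempty, setIntegral_empty] at hlim
  obtain ⟨n, hn⟩ := (hlim.eventually (gt_mem_nhds hγ)).exists
  exact ⟨a - n, by simp, hn⟩

/-- Sharpness of the exponent at the Type-I rate: `∫_{t<T} (C/√(−t))² dt = ∞` for `C ≠ 0`,
`T ≤ 0` — the Type-I majorant is NOT square integrable on any past slab (`∫ dt/(−t)` diverges
logarithmically), so `oseenMild_eq_zero` stops one logarithm short of stub L' (stmt-4050). [folklore] -/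
theorem not_integrableOn_typeIRate_sq {C T : ℝ} (hC : C ≠ 0) (hT : T ≤ 0) :
    ¬ IntegrableOn (fun t => (C / Real.sqrt (-t)) ^ 2) (Iio T) := by
  intro h
  have h1 : IntegrableOn (fun t => (C / Real.sqrt (-t)) ^ 2) (Iio (T - 1)) :=
    h.mono_set (Iio_subset_Iio (by linarith))
  have h2 : IntegrableOn (fun t : ℝ => C ^ 2 * (-t) ^ (-1 : ℝ)) (Iio (T - 1)) := by
    refine h1.congr_fun (fun t ht => ?_) measurableSet_Iio
    have ht' : 0 < -t := by simp only [mem_Iio] at ht; linarith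
    show (C / Real.sqrt (-t)) ^ 2 = C ^ 2 * (-t) ^ (-1 : ℝ)
    rw [div_pow, Real.sq_sqrt ht'.le, Real.rpow_neg_one, div_eq_mul_inv]
  have h3 : IntegrableOn (fun t : ℝ => (-t) ^ (-1 : ℝ)) (Iio (T - 1)) := by
    have h3' : IntegrableOn (fun t : ℝ => (C ^ 2)⁻¹ * (C ^ 2 * (-t) ^ (-1 : ℝ))) (Iio (T - 1)) :=
      h2.const_mul _
    refine h3'.congr_fun (fun t _ => ?_) measurableSet_Iio
    show (C ^ 2)⁻¹ * (C ^ 2 * (-t) ^ (-1 : ℝ)) = (-t) ^ (-1 : ℝ)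
    rw [← mul_assoc, inv_mul_cancel₀ (pow_ne_zero 2 hC), one_mul]
  have h4 : IntegrableOn (fun t : ℝ => t ^ (-1 : ℝ)) (Ioi (1 - T)) := by
    have hpre : (fun t : ℝ => -t) ⁻¹' Ioi (1 - T) = Iio (T - 1) := by
      ext t; simp only [mem_preimage, mem_Ioi, mem_Iio]; constructor <;> intro h <;> linarith
    have key := ((Measure.measurePreserving_neg (volume : Measure ℝ)).integrableOn_comp_preimage
      (Homeomorph.neg ℝ).measurableEmbedding (f := fun t : ℝ => t ^ (-1 : ℝ)) (s := Ioi (1 - T)))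
    rw [hpre] at key
    exact key.1 h3
  have h5 : (-1 : ℝ) < -1 := (integrableOn_Ioi_rpow_iff (by linarith : (0 : ℝ) < 1 - T)).1 h4
  exact lt_irrefl _ h5

/-! ### The bilinear term split at `t − δ` -/

/-- **Far/near bound of the Duhamel term.** If on `(s, t − δ)` the slices are bounded by a
majorant `g` with `g²` integrable there, and on `[t − δ, t)` by the constant `N`, then
`‖B¹_s(v,v)(t)(x)‖ ≤ C₀ (δ^{-1/2} ∫_{(s,t−δ)} g² + N² · 2δ^{1/2})`, `C₀ = oseenSliceConst`
(KNSS 2009 §4 p. 8 bilinear bound with time-dependent slice bounds,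
`norm_oseenDuhamel_le_setIntegral`, and `(t − τ)^{-1/2} ≤ δ^{-1/2}` on the far piece). [cite: KochNadirashviliSereginSverak2009, §4 p. 8 (arXiv:0709.3599)] -/
theorem norm_oseenDuhamel_le_far_near
    {v : ℝ → EuclideanSpace ℝ (Fin 3) → EuclideanSpace ℝ (Fin 3)} {g : ℝ → ℝ} {s t δ N : ℝ}
    (hδ : 0 < δ) (hs : s < t - δ)
    (hfar : ∀ τ ∈ Ioo s (t - δ), ∀ y, ‖v τ y‖ ≤ g τ)
    (hnear : ∀ τ ∈ Ico (t - δ) t, ∀ y, ‖v τ y‖ ≤ N)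
    (hgi : IntegrableOn (fun τ => g τ ^ 2) (Ioo s (t - δ))) (x : EuclideanSpace ℝ (Fin 3)) :
    ‖oseenDuhamel 1 s v v t x‖ ≤
      oseenSliceConst (EuclideanSpace ℝ (Fin 3)) *
        (δ ^ (-(1 / 2 : ℝ)) * (∫ τ in Ioo s (t - δ), g τ ^ 2) + N ^ 2 * (2 * δ ^ (1 / 2 : ℝ))) := by
  have hC₀ : 0 ≤ oseenSliceConst (EuclideanSpace ℝ (Fin 3)) := (oseenSliceConst_pos).le
  have htδ : t - δ < t := by linarith
  -- the piecewise slice majorant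
  set b : ℝ → ℝ := fun τ => if τ < t - δ then g τ else N with hb
  have hslice : ∀ τ ∈ Ioo s t, ∀ y, ‖v τ y‖ ≤ b τ := by
    intro τ hτ y
    by_cases h : τ < t - δ
    · rw [hb]; simp only [if_pos h]; exact hfar τ ⟨hτ.1, h⟩ y
    · rw [hb]; simp only [if_neg h]; exact hnear τ ⟨not_lt.1 h, hτ.2⟩ y
  -- the integrand and its two pieces
  set F : ℝ → ℝ := fun τ => (t - τ) ^ (-(1 / 2 : ℝ)) * (b τ * b τ) with hF
  have hF_far : EqOn F (fun τ => (t - τ) ^ (-(1 / 2 : ℝ)) * g τ ^ 2) (Ioo s (t - δ)) := by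
    intro τ hτ
    simp only [hF, hb, if_pos hτ.2, pow_two]
  have hF_near : EqOn F (fun τ => (t - τ) ^ (-(1 / 2 : ℝ)) * N ^ 2) (Ico (t - δ) t) := by
    intro τ hτ
    simp only [hF, hb, if_neg (not_lt.2 hτ.1), pow_two]
  -- integrability of the far piece: continuous kernel on the compact `[s, t − δ]` times `g²`
  have hker_cont : ContinuousOn (fun τ : ℝ => (t - τ) ^ (-(1 / 2 : ℝ))) (Icc s (t - δ)) := by
    refine ContinuousOn.rpow_const (continuousOn_const.sub continuousOn_id) fun τ hτ => ?_
    exact Or.inl (by have := hτ.2; intro h0; linarith)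
  have hfar_int' : IntegrableOn (fun τ => (t - τ) ^ (-(1 / 2 : ℝ)) * g τ ^ 2) (Ioo s (t - δ)) :=
    hgi.continuousOn_mul_of_subset hker_cont isCompact_Icc measurableSet_Ioo Ioo_subset_Icc_self
  have hfar_int : IntegrableOn F (Ioo s (t - δ)) := hfar_int'.congr_fun hF_far.symm measurableSet_Ioo
  -- integrability of the near piece
  have hnear_int'' : IntegrableOn (fun τ => (t - τ) ^ (-(1 / 2 : ℝ)) * N ^ 2) (Ioo (t - δ) t) :=
    (integrableOn_sub_rpow_Ioo (by norm_num)).mul_const _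
  have hnear_int' : IntegrableOn (fun τ => (t - τ) ^ (-(1 / 2 : ℝ)) * N ^ 2) (Ico (t - δ) t) := by
    rw [integrableOn_Ico_iff_integrableOn_Ioo]; exact hnear_int''
  have hnear_int : IntegrableOn F (Ico (t - δ) t) := hnear_int'.congr_fun hF_near.symm measurableSet_Ico
  -- the whole interval
  have hunion : Ioo s (t - δ) ∪ Ico (t - δ) t = Ioo s t := Ioo_union_Ico_eq_Ioo hs htδ.le
  have hdisj : Disjoint (Ioo s (t - δ)) (Ico (t - δ) t) :=
    disjoint_left.2 fun τ h1 h2 => (not_le.2 h1.2) h2.1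
  have hF_int : IntegrableOn F (Ioo s t) := by
    rw [← hunion]; exact hfar_int.union hnear_int
  -- the KNSS bilinear bound with the piecewise majorant
  have hB := norm_oseenDuhamel_le_setIntegral (E := EuclideanSpace ℝ (Fin 3))
    (a := v) (b := v) (Ma := b) (Mb := b) hslice hslice hF_int x
  -- bound the two pieces
  have hsplit : ∫ τ in Ioo s t, F τ = (∫ τ in Ioo s (t - δ), F τ) + ∫ τ in Ico (t - δ) t, F τ := by
    rw [← hunion]; exact setIntegral_union hdisj measurableSet_Ico hfar_int hnear_int
  have hfar_le : ∫ τ in Ioo s (t - δ), F τ ≤ δ ^ (-(1 / 2 : ℝ)) * ∫ τ in Ioo s (t - δ), g τ ^ 2 := by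
    rw [setIntegral_congr_fun measurableSet_Ioo hF_far, ← integral_const_mul]
    refine setIntegral_mono_on hfar_int' (hgi.const_mul _) measurableSet_Ioo fun τ hτ => ?_
    have hle : δ ≤ t - τ := by have := hτ.2; linarith
    have hk : (t - τ) ^ (-(1 / 2 : ℝ)) ≤ δ ^ (-(1 / 2 : ℝ)) :=
      Real.rpow_le_rpow_of_nonpos hδ hle (by norm_num)
    exact mul_le_mul_of_nonneg_right hk (sq_nonneg _)
  have hnear_eq : ∫ τ in Ico (t - δ) t, F τ = N ^ 2 * (2 * δ ^ (1 / 2 : ℝ)) := by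
    rw [setIntegral_congr_fun measurableSet_Ico hF_near, integral_Ico_eq_integral_Ioo,
      integral_mul_const, setIntegral_Ioo_sub_rpow_neg_half htδ.le, sub_sub_cancel]
    ring
  calc ‖oseenDuhamel 1 s v v t x‖
      ≤ oseenSliceConst (EuclideanSpace ℝ (Fin 3)) * ∫ τ in Ioo s t, F τ := hB
    _ ≤ oseenSliceConst (EuclideanSpace ℝ (Fin 3)) *
        (δ ^ (-(1 / 2 : ℝ)) * (∫ τ in Ioo s (t - δ), g τ ^ 2) + N ^ 2 * (2 * δ ^ (1 / 2 : ℝ))) := by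
      rw [hsplit, hnear_eq]
      exact mul_le_mul_of_nonneg_left (add_le_add hfar_le le_rfl) hC₀

/-! ### The main theorem -/

/-- **A finite `L²_t L^∞_x` budget on a past slab kills a mild bounded ancient solution.**
Let `v` be continuous and uniformly bounded on `(−∞,0) × ℝ³` and Oseen-mild
(`v(t) = e^{(t−s)Δ}v(s) − B¹_s(v,v)(t)`, `s < t < 0`; print's class, KNSS 2009 §4 (i), WITHOUT
the divergence constraint).  If for one `T` and one majorant `g` one has `‖v(t,x)‖ ≤ g(t)` for
all `t < T`, `x`, and `∫_{t<T} g(t)² dt < ∞`, then `v ≡ 0` on the whole slab.  Proof: Volterra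
bootstrap `N ≤ C₀(δ^{-1/2}G + 2δ^{1/2}N²)` for `N = sup_{t<t₁}‖v‖`, `G = ∫_{t<t₁} g² < 1/(9C₀²)`
(module docstring), then forward uniqueness from a zero slice.  The endpoint (`q = ∞`) member of
the scale-invariant Ladyzhenskaya–Prodi–Serrin family; sharp at the Type-I rate by one logarithm
(`not_integrableOn_typeIRate_sq`). [cite: KochNadirashviliSereginSverak2009, §4 p. 8 and (4.3)–(4.4) (arXiv:0709.3599)] -/
theorem oseenMild_eq_zero
    (v : ℝ → EuclideanSpace ℝ (Fin 3) → EuclideanSpace ℝ (Fin 3))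
    (hvc : ContinuousOn (uncurry v) (Iio 0 ×ˢ univ))
    (hvK : ∃ K : ℝ, ∀ t < 0, ∀ x, ‖v t x‖ ≤ K)
    (hvm : ∀ s t : ℝ, s < t → t < 0 → ∀ x,
      v t x = UnboundedOperators.heatExtension (v s) (t - s) x - oseenDuhamel 1 s v v t x)
    {g : ℝ → ℝ} {T : ℝ} (hg : ∀ t < T, ∀ x, ‖v t x‖ ≤ g t)
    (hint : IntegrableOn (fun t => g t ^ 2) (Iio T)) :
    ∀ t < 0, ∀ x, v t x = 0 := by
  obtain ⟨K, hK⟩ := hvK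
  -- the constant and the threshold
  set C₀ : ℝ := oseenSliceConst (EuclideanSpace ℝ (Fin 3)) with hC₀def
  have hC₀ : 0 < C₀ := oseenSliceConst_pos
  set γ : ℝ := 1 / (9 * C₀ ^ 2) with hγ
  have hγpos : 0 < γ := by positivity
  -- a time `t₁ ≤ min T 0` with small tail budget
  obtain ⟨t₁', ht₁'T, ht₁'⟩ := exists_setIntegral_Iio_sq_lt hint hγpos
  set t₁ : ℝ := min t₁' 0 with ht₁def
  have ht₁0 : t₁ ≤ 0 := min_le_right _ _
  have ht₁T : t₁ ≤ T := (min_le_left _ _).trans ht₁'T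
  have hintt₁' : IntegrableOn (fun t => g t ^ 2) (Iio t₁') := hint.mono_set (Iio_subset_Iio ht₁'T)
  set G : ℝ := ∫ t in Iio t₁, g t ^ 2 with hGdef
  have hG0 : 0 ≤ G := setIntegral_nonneg measurableSet_Iio fun t _ => sq_nonneg _
  have hGle : G ≤ ∫ t in Iio t₁', g t ^ 2 :=
    setIntegral_mono_set hintt₁' (ae_of_all _ fun t => sq_nonneg (g t))
      (Iio_subset_Iio (min_le_left _ _)).eventuallyLE
  have hGγ : G < γ := hGle.trans_lt ht₁'
  -- the supremum `N` of `‖v‖` below `t₁`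
  set S : Set ℝ := {r | ∃ t, t < t₁ ∧ ∃ x : EuclideanSpace ℝ (Fin 3), r = ‖v t x‖} with hSdef
  have hSb : BddAbove S := by
    refine ⟨K, ?_⟩
    rintro r ⟨t, ht, x, rfl⟩
    exact hK t (lt_of_lt_of_le ht ht₁0) x
  have hSn : S.Nonempty := ⟨‖v (t₁ - 1) 0‖, t₁ - 1, by linarith, 0, rfl⟩
  set N : ℝ := sSup S with hNdef
  have hN : ∀ t < t₁, ∀ x, ‖v t x‖ ≤ N := fun t ht x => le_csSup hSb ⟨t, ht, x, rfl⟩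
  have hN0 : 0 ≤ N := (norm_nonneg _).trans (hN (t₁ - 1) (by linarith) 0)
  -- the Volterra inequality, parametrised by `ρ = √δ`
  have hclaim : ∀ ρ : ℝ, 0 < ρ → N ≤ C₀ * (ρ⁻¹ * G + N ^ 2 * (2 * ρ)) := by
    intro ρ hρ
    set δ : ℝ := ρ ^ 2 with hδdef
    have hδ : 0 < δ := by positivity
    have hδhalf : δ ^ (1 / 2 : ℝ) = ρ := by
      rw [← Real.sqrt_eq_rpow, hδdef, Real.sqrt_sq hρ.le]
    have hδnhalf : δ ^ (-(1 / 2 : ℝ)) = ρ⁻¹ := by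
      rw [Real.rpow_neg hδ.le, hδhalf]
    refine csSup_le hSn ?_
    rintro r ⟨t, ht, x, rfl⟩
    have ht0 : t < 0 := lt_of_lt_of_le ht ht₁0
    refine le_of_forall_pos_le_add fun η hη => ?_
    obtain ⟨s, hs, hgs⟩ :=
      exists_lt_and_le_of_integrableOn_sq hint (show t - δ ≤ T by linarith) hη
    have hst : s < t := by linarith
    have hsT : s < T := by linarith
    -- the caloric term is small
    have hheat : ‖UnboundedOperators.heatExtension (v s) (t - s) x‖ ≤ η :=
      UnboundedOperators.norm_heatExtension_le (fun z => (hg s hsT z).trans hgs) (sub_pos.2 hst) x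
    -- the bilinear term
    have hgi : IntegrableOn (fun τ => g τ ^ 2) (Ioo s (t - δ)) :=
      hint.mono_set fun τ hτ => lt_of_lt_of_le (hτ.2.trans_le (by linarith)) le_rfl
    have hduh := norm_oseenDuhamel_le_far_near (v := v) (N := N) hδ hs
      (fun τ hτ y => hg τ (by linarith [hτ.2]) y)
      (fun τ hτ y => hN τ (lt_of_lt_of_le hτ.2 ht.le) y) hgi x
    have hfarG : ∫ τ in Ioo s (t - δ), g τ ^ 2 ≤ G :=
      setIntegral_mono_set (hint.mono_set (Iio_subset_Iio ht₁T))
        (ae_of_all _ fun τ => sq_nonneg (g τ))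
        (show Ioo s (t - δ) ⊆ Iio t₁ from fun τ hτ =>
          lt_trans hτ.2 (by linarith)).eventuallyLE
    have hρinv : 0 ≤ ρ⁻¹ := inv_nonneg.2 hρ.le
    calc ‖v t x‖
        = ‖UnboundedOperators.heatExtension (v s) (t - s) x - oseenDuhamel 1 s v v t x‖ := by
          rw [← hvm s t hst ht0 x]
      _ ≤ ‖UnboundedOperators.heatExtension (v s) (t - s) x‖ + ‖oseenDuhamel 1 s v v t x‖ :=
          norm_sub_le _ _
      _ ≤ η + C₀ * (ρ⁻¹ * G + N ^ 2 * (2 * ρ)) := by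
          refine add_le_add hheat (hduh.trans ?_)
          rw [hδhalf, hδnhalf]
          have : ρ⁻¹ * (∫ τ in Ioo s (t - δ), g τ ^ 2) ≤ ρ⁻¹ * G :=
            mul_le_mul_of_nonneg_left hfarG hρinv
          exact mul_le_mul_of_nonneg_left (add_le_add this le_rfl) hC₀.le
      _ = C₀ * (ρ⁻¹ * G + N ^ 2 * (2 * ρ)) + η := add_comm _ _
  -- `N = 0`
  have hN_zero : N = 0 := by
    by_contra hne
    have hNpos : 0 < N := lt_of_le_of_ne hN0 (Ne.symm hne)
    set G₁ : ℝ := (G + γ) / 2 with hG₁def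
    have hG₁pos : 0 < G₁ := by rw [hG₁def]; linarith
    have hGG₁ : G ≤ G₁ := by rw [hG₁def]; linarith
    have hG₁γ : G₁ < γ := by rw [hG₁def]; linarith
    set σ : ℝ := Real.sqrt G₁ with hσdef
    have hσpos : 0 < σ := Real.sqrt_pos.2 hG₁pos
    have hσsq : σ ^ 2 = G₁ := Real.sq_sqrt hG₁pos.le
    set ρ : ℝ := σ / N with hρdef
    have hρpos : 0 < ρ := div_pos hσpos hNpos
    have h1 := hclaim ρ hρpos
    -- `ρ⁻¹ G ≤ ρ⁻¹ G₁ = N σ` and `N² · 2ρ = 2 N σ`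
    have h2 : ρ⁻¹ * G ≤ N * σ := by
      have : ρ⁻¹ * G ≤ ρ⁻¹ * G₁ := mul_le_mul_of_nonneg_left hGG₁ (inv_nonneg.2 hρpos.le)
      refine this.trans (le_of_eq ?_)
      rw [hρdef, inv_div, ← hσsq]
      field_simp
    have h3 : N ^ 2 * (2 * ρ) = 2 * (N * σ) := by
      rw [hρdef]; field_simp
    have h4 : N ≤ C₀ * (3 * (N * σ)) := by
      refine h1.trans ?_
      rw [h3]
      exact mul_le_mul_of_nonneg_left (by linarith) hC₀.le
    -- divide by `N > 0`: `1 ≤ 3 C₀ σ`, square: `1 ≤ 9 C₀² G₁ < 9 C₀² γ = 1`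
    have h5 : 1 ≤ 3 * C₀ * σ := by
      have h4' : N * 1 ≤ N * (3 * C₀ * σ) := by rw [mul_one]; refine h4.trans (le_of_eq (by ring))
      exact le_of_mul_le_mul_left h4' hNpos
    have h6 : 1 ≤ 9 * C₀ ^ 2 * G₁ := by
      have h5' : (1 : ℝ) ≤ (3 * C₀ * σ) ^ 2 := by nlinarith
      calc (1 : ℝ) ≤ (3 * C₀ * σ) ^ 2 := h5'
        _ = 9 * C₀ ^ 2 * σ ^ 2 := by ring
        _ = 9 * C₀ ^ 2 * G₁ := by rw [hσsq]
    have h7 : 9 * C₀ ^ 2 * G₁ < 9 * C₀ ^ 2 * γ :=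
      mul_lt_mul_of_pos_left hG₁γ (by positivity)
    have h8 : 9 * C₀ ^ 2 * γ = 1 := by
      rw [hγ]; field_simp
    linarith
  -- vanishing below `t₁`
  have hzero : ∀ t < t₁, ∀ x, v t x = 0 := fun t ht x =>
    norm_le_zero_iff.1 ((hN t ht x).trans hN_zero.le)
  -- forward uniqueness from the zero slice at `t₁ − 1`
  have hfwd := oseenMild_eq_zero_after_of_slice_eq_zero hvc ⟨K, hK⟩ hvm
    (s₁ := t₁ - 1) (fun x => hzero (t₁ - 1) (by linarith) x)
  intro t ht x
  by_cases h : t < t₁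
  · exact hzero t h x
  · exact hfwd t ⟨by linarith [not_lt.1 h], ht⟩ x

/-! ### Stub S3ᵐ (persistent regime): infinite endpoint budget -/

/-- **The persistent class has infinite `L²_t L^∞_x` budget.** In print's class (continuous,
uniformly bounded, Oseen-mild on `(−∞,0) × ℝ³`; divergence-freeness not needed), a field which is
NOT in the Type-I regime (the hypothesis of `stub_persistent_mild_backward_L3_recurrence`) admits
no square-integrable sup-norm majorant on any past slab: for every `g`, `T` with `‖v(t,x)‖ ≤ g(t)`
(`t < T`), `∫_{t<T} g² = ∞`.  (Contrapositive of `oseenMild_eq_zero`: a finite budget gives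
`v ≡ 0`, which is Type-I with constant `0`.)  So stub S3ᵐ — and, after a Galilean boost,
`oseenMild_const` — is about flows of infinite endpoint budget against every constant. [cite: KochNadirashviliSereginSverak2009, §4 p. 8 (arXiv:0709.3599)] -/
theorem not_integrableOn_sq_of_persistent
    (v : ℝ → EuclideanSpace ℝ (Fin 3) → EuclideanSpace ℝ (Fin 3))
    (hvc : ContinuousOn (uncurry v) (Iio 0 ×ˢ univ))
    (hvK : ∃ K : ℝ, ∀ t < 0, ∀ x, ‖v t x‖ ≤ K)
    (hvm : ∀ s t : ℝ, s < t → t < 0 → ∀ x,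
      v t x = UnboundedOperators.heatExtension (v s) (t - s) x - oseenDuhamel 1 s v v t x)
    (hpers : ¬ ∃ C : ℝ, ∀ t < 0, ∀ x, ‖v t x‖ ≤ C / Real.sqrt (-t))
    {g : ℝ → ℝ} {T : ℝ} (hg : ∀ t < T, ∀ x, ‖v t x‖ ≤ g t) :
    ¬ IntegrableOn (fun t => g t ^ 2) (Iio T) := by
  intro hint
  have hz := oseenMild_eq_zero v hvc hvK hvm hg hint
  exact hpers ⟨0, fun t ht x => by rw [hz t ht x, norm_zero, zero_div]⟩

end Summit.NavierStokesRegularity.NavierStokesRegularity.Theorems.SupSqBudget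

end
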